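import Summits.ResolutionOfSingularities.ResolutionOfSingularities.Theorems.HilbertSamuelEliminationSigmaMaxModificationsCorridor3WLadderMovingTwoDefs
import Summits.ResolutionOfSingularities.ResolutionOfSingularities.Theorems.HilbertSamuelEliminationSigmaMaxModificationsCorridor3WLadderMovingBeta
import Literature.AlgebraicGeometry.Resolution.NormalCrossingsStrictification
import HarnessLib

/-!
# [OURS · L1 W4.2] Row `stub_Wlow3M_two` (crux chain w42, line `w_ladder` v5b) — the characteristic-2 threefold row
# CLOSED MODULO FOUR CHARACTERISTIC-FREE INPUTS (proved reductions over `…Corridor3WLadderMovingTwoDefs`)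

Stub worker res-L1-w42-stub-3 (gen 3); CHAIN v3.8 / v3.8a rulings (D-2) «β and γ have the SAME status at W-low», (a-4)
«the two Props + the β ∪ γ units-half assembly modulo them; strata via stub-4's Q-free row». What is PROVED here:

* §1 (F1♯) `GeomDirHypothesis` («`char κ(x) = 0 ∨ ē_x + 2 ≤ 2·char`») follows from (F1) `CharHypothesis` (`ē_x ≤ dim X`) and
  is AUTOMATIC when `ē_x ≤ 2` (a field has characteristic `0` or a prime `≥ 2`) — so it holds at every point of a W-low chain
  and at the initial point of every fundamental unit.
* §2 The OURS carriers sit between the typed facts: `Corollary637 → Corollary637_geomDir → Corollary637_char`, and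
  `KeyTheorem640_geomDir_isolated ↔ KeyTheorem640_isolated` (units have `ē = 2`): for Thm. 6.40 the honest carrier of the
  characteristic-2 row is the typed char-free `KeyTheorem640_isolated` itself («print + 2.14♯ + memo», BETA-UNITS-SCOPE).
* §3 UNITS-half for EVERY prime and EVERY maximal origin: `WlowUnitsM p` from `KeyTheorem640_isolated` + the third door
  restricted to isolated W-low stages with `e ≤ 1` (stated inline) + `UnitTowerExtractionFreeM p` (idea-2's bridge without the
  `CharHypothesis` conjunct, which idea-2's `UnitTowerExtractionM p` implies); join with the strata-half `WlowStrataM p` gives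
  `WlowM p` (`wlowM_assembled_free`).
* §4 `WlowM p` gives BOTH registered W-low rows (`wlow3TwoM_of_wlowM`, `wlow3CharM_of_wlowM`); hence
  **`stub_Wlow3M_two_of_free`**: the registered stub `∀ p, p.Prime → Wlow3TwoM p` from the four inputs AT THE PRIME 2 ONLY
  (other primes vacuous, `stub_Wlow3M_two_of_two` of `…MovingBeta`), and `wlow_rows_of_free`: both W-low stubs from the same
  characteristic-free inputs prime by prime — the (F1)/¬(F1) regime cut is bookkeeping (ruling v3.8-D (2)).

NOT proved here (the row's remaining second-layer obligations, named): `UnitTowerExtractionFreeM 2` (bridge B1′, finite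
segments; stub-2's construction minus `CharHypothesis`), the restricted third door at `p = 2` (Cor. 6.37-type termination at
isolated stages with `e ≤ 1 ≤ ē ≤ 2`: `Corollary637_geomDir` + 2.14♯ via a point-sequence bridge), `WlowStrataM 2` (G1′,
stub-4), and the facts themselves (`KeyTheorem640_isolated` char-free = print + 2.14♯ `Directrix214Sharp` ← F14–F16 + memo).

OURS (cell res-hironaka, slot W4.2); NOT statements of the manuscript [Hironaka2017] nor of [CossartJannsenSaito2020];
AI-drafted, weaker than expert review. References: CJS LNM 2270 p. 103 (F1), Def. 2.21, Thm. 3.10 (4), Thm. 3.14, Thm. 6.35,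
Cor. 6.37, Def. 6.38, Thm. 6.40, Thm. 10.2 [CossartJannsenSaito2020]; H. Mizutani, Nagoya Math. J. 52 (1973) Thm. 2.8
[Mizutani1973HironakaGroupSchemes]; memo `HOME/L/res-L1-w42-stub-3/BETA-UNITS-SCOPE.md` (sha16 1de7b2d81fb7044c).
-/

noncomputable section

-- plan-1/idea-2 module setting kept verbatim (namespace `…Corridor3.Moving` re-enters `…Corridor3`)
set_option linter.dupNamespace false

open CategoryTheory AlgebraicGeometry TopologicalSpace IsLocalRing
open Summit.ResolutionOfSingularities.ResolutionOfSingularities.Theorems.CampaignW42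
open Literature.AlgebraicGeometry.Resolution Literature.RingTheory.HilbertSamuel
open Literature.AlgebraicGeometry.CossartJannsenSaito2020
open Summit.ResolutionOfSingularities.ResolutionOfSingularities.Theses.HilbertSamuelElimination
open Summit.ResolutionOfSingularities.ResolutionOfSingularities.Theorems.SigmaMaxModificationsCorridor3

namespace Summit.ResolutionOfSingularities.ResolutionOfSingularities.Theorems.SigmaMaxModificationsCorridor3.Moving

universe u


section Two

open Summit.ResolutionOfSingularities.ResolutionOfSingularities.Theorems.SigmaMaxModificationsCorridor3.Helpers
  (ClosedOriginGeomDirDimNonincrease QPerfectResidueField QCharRegime)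

variable {R : ∀ S : Scheme.{u}, CentreSeq S → Prop} {N : ℕ} {ν : ℕ → ℕ}

/-! ## §1. (F1♯) versus (F1), and (F1♯) is automatic at `ē ≤ 2` -/

/-- The characteristic of the residue field of a point is `0` or a prime. [folklore] -/
theorem ringChar_residueField_zero_or_prime (X : Scheme.{u}) (x : X) :
    ringChar (ResidueField (X.presheaf.stalk x)) = 0 ∨ (ringChar (ResidueField (X.presheaf.stalk x))).Prime := by
  rcases CharP.char_is_prime_or_zero (ResidueField (X.presheaf.stalk x)) (ringChar (ResidueField (X.presheaf.stalk x)))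
    with h | h
  · exact Or.inr h
  · exact Or.inl h

/-- **(F1♯) is AUTOMATIC when `ē_x(X) ≤ 2`** (the characteristic of a field is `0` or a prime `≥ 2`): in particular at
every point of a W-low chain and at the initial point of every fundamental unit. [folklore] -/
theorem geomDirHypothesis_of_geomDirDim_le_two {X : Scheme.{u}} [IsLocallyNoetherian X] {x : X}
    (h : Scheme.geomDirDim X x ≤ 2) : GeomDirHypothesis X x := by
  rcases ringChar_residueField_zero_or_prime X x with h0 | hp
  · exact Or.inl h0
  · exact Or.inr (by have := hp.two_le; omega)

/-- **(F1) ⇒ (F1♯)**: `ē_x(X) ≤ dim 𝒪_{X,x} ≤ dim X` (CJS Def. 2.21). [cite: CossartJannsenSaito2020, Def. 2.21, Thm. 10.2] -/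
theorem geomDirHypothesis_of_charHypothesis {X : Scheme.{u}} [IsLocallyNoetherian X] {x : X}
    (h : CharHypothesis X x) : GeomDirHypothesis X x := by
  obtain ⟨d, hd, hc⟩ := h
  rcases hc with h0 | hle
  · exact Or.inl h0
  · right
    have h1 : (Scheme.geomDirDim X x : WithBot ℕ∞) ≤ (d : WithBot ℕ∞) := by
      rw [← hd]
      exact (Scheme.natCast_geomDirDim_le_ringKrullDim_stalk x).trans (ringKrullDim_stalk_le_topologicalKrullDim X x)
    have h2 : Scheme.geomDirDim X x ≤ d := by exact_mod_cast h1
    omega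

/-! ## §2. The OURS carriers between the typed char-free and print-faithful facts -/

/-- `Corollary637` (char-free, typed, stronger than print) ⇒ the OURS carrier `Corollary637_geomDir`. [folklore] -/
theorem corollary637_geomDir_of_corollary637 (h : Corollary637.{u}) : Corollary637_geomDir.{u} :=
  fun T N x m hset _ hF hiso he => h T N x m hset hF hiso he

/-- The OURS carrier `Corollary637_geomDir` ⇒ the print-faithful `Corollary637_char` ((F1) ⇒ (F1♯)). [folklore] -/
theorem corollary637_char_of_geomDir (h : Corollary637_geomDir.{u}) : Corollary637_char.{u} :=
  fun T N x m hset hchar hF hiso he =>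
    h T N x m hset (@geomDirHypothesis_of_charHypothesis (T.X 0) (T.ln 0) x hchar) hF hiso he

/-- **`KeyTheorem640_geomDir_isolated ↔ KeyTheorem640_isolated`**: (F1♯) holds at the initial point of a fundamental unit
(`ē = 2`, Def. 6.38 (i)), so the (F1♯)-form of Thm. 6.40 IS the typed char-free form. [folklore] -/
theorem keyTheorem640_geomDir_isolated_iff : KeyTheorem640_geomDir_isolated.{u} ↔ KeyTheorem640_isolated.{u} := by
  constructor
  · intro h T N len pt hset hchain hiso
    refine h T N len pt hset ?_ hchain hiso
    have h2 : (T.drop (unitStart len 0)).geomDirDimAt 0 (pt 0) = 2 := (hchain 0).geomDirDim_eq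
    exact @geomDirHypothesis_of_geomDirDim_le_two (T.X 0) (T.ln 0) (pt 0) (le_of_eq h2)
  · intro h T N len pt hset _ hchain hiso
    exact h T N len pt hset hchain hiso

/-- The (F1)-form follows from the (F1♯)-form (equivalently from the char-free form). [folklore] -/
theorem keyTheorem640_char_isolated_of_geomDir (h : KeyTheorem640_geomDir_isolated.{u}) :
    KeyTheorem640_char_isolated.{u} :=
  fun T N len pt hset hchar hchain hiso =>
    h T N len pt hset (@geomDirHypothesis_of_charHypothesis (T.X 0) (T.ln 0) (pt 0) hchar) hchain hiso

/-! ## §3. The characteristic-free extraction and the units-half from `KeyTheorem640_isolated` -/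

/-- idea-2's extraction (with the `CharHypothesis` conjunct) gives the characteristic-free one. [folklore] -/
theorem unitTowerExtractionFreeM_of_unitTowerExtractionM {p : ℕ} (h : UnitTowerExtractionM p) :
    UnitTowerExtractionFreeM p := by
  intro R hRf hRa ν X _ x hX c h0 hstep hG hmov hrec he
  obtain ⟨T, len, pt, hset, -, hchain, hiso⟩ := h R hRf hRa ν X x hX c h0 hstep hG hmov hrec he
  exact ⟨T, len, pt, hset, hchain, hiso⟩

/-- **PROVED REDUCTION (all primes, all origins): the UNITS-half `WlowUnitsM p` from the char-free typed F-key
`KeyTheorem640_isolated` + the third door restricted to W-low stages + the characteristic-free extraction.** The third door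
is needed only at in-scope ISOLATED stages with `e ≤ 1` AND `ē ≤ 2` (where 2.14♯ applies at `p = 2`); it is stated inline
in that restricted form. [cite: CossartJannsenSaito2020, Thm. 6.40, Cor. 6.37] -/
theorem wlowUnitsM_of_extraction_free {p : ℕ} (hK : KeyTheorem640_isolated.{0})
    (hlow : ∀ (R : ∀ S : Scheme.{0}, CentreSeq S → Prop), OracleFunctional R → OracleAdmissible R →
      ∀ (ν : ℕ → ℕ) (s : MarkedStage.{0}), InScopeM p R 3 ν s → Iso 3 s → dirDim s ≤ 1 → s.geomDirDim ≤ 2 →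
        NoMovingNearChainFrom R 3 ν s fun _ => True)
    (hext : UnitTowerExtractionFreeM p) : WlowUnitsM p := by
  intro R hRf hRa ν X _ x hX
  rintro ⟨c, h0, hstep, hG, hmov, hrec⟩
  by_cases hlowstage : ∃ m, Iso 3 (c m) ∧ dirDim (c m) ≤ 1
  · obtain ⟨m, hiso, hdir⟩ := hlowstage
    have hscope : InScopeM p R 3 ν (c m) := ⟨X, ‹_›, x, hX, reaches_chain h0 hstep m⟩
    exact hlow R hRf hRa ν (c m) hscope hiso hdir (hG m)
      ⟨fun n => c (m + n), Relation.ReflTransGen.refl, fun n => hstep (m + n), fun _ => trivial, io_shift hmov m⟩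
  · push Not at hlowstage
    have he : ∀ n, Iso 3 (c n) → dirDim (c n) = 2 ∧ (c n).geomDirDim = 2 := by
      intro n hiso
      have h1 := hlowstage n hiso
      have h2 := dirDim_le_geomDirDim (c n)
      have h3 := hG n
      exact ⟨by omega, by omega⟩
    obtain ⟨T, len, pt, hset, hchain, hisoT⟩ := hext R hRf hRa ν X x hX c h0 hstep hG hmov hrec he
    exact hK T 3 len pt hset hchain hisoT

/-- The unrestricted third door `IsoLowDirDimTerminatesM p` (idea-2 §3a) gives the restricted one. [folklore] -/
theorem wlowUnitsM_of_extraction_free' {p : ℕ} (hK : KeyTheorem640_isolated.{0}) (hlow : IsoLowDirDimTerminatesM p)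
    (hext : UnitTowerExtractionFreeM p) : WlowUnitsM p :=
  wlowUnitsM_of_extraction_free hK (fun R hRf hRa ν s hs hiso hdir _ => hlow R hRf hRa ν s hs hiso hdir) hext

/-- **`WlowM p` assembled, characteristic-free inputs (PROVED reduction)**: `KeyTheorem640_isolated` + restricted third door +
`UnitTowerExtractionFreeM p` + the strata-half `WlowStrataM p` (G1′). [cite: CossartJannsenSaito2020, Thm. 6.40, Cor. 6.37, Thm. 6.35] -/
theorem wlowM_assembled_free {p : ℕ} (hK : KeyTheorem640_isolated.{0})
    (hlow : ∀ (R : ∀ S : Scheme.{0}, CentreSeq S → Prop), OracleFunctional R → OracleAdmissible R →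
      ∀ (ν : ℕ → ℕ) (s : MarkedStage.{0}), InScopeM p R 3 ν s → Iso 3 s → dirDim s ≤ 1 → s.geomDirDim ≤ 2 →
        NoMovingNearChainFrom R 3 ν s fun _ => True)
    (hext : UnitTowerExtractionFreeM p) (hS : WlowStrataM p) : WlowM p :=
  maxOriginNoMovingNearChainAt_of_recurrence hS (wlowUnitsM_of_extraction_free hK hlow hext)

/-! ## §4. From `WlowM p` to both registered W-low rows (the regime cut is bookkeeping, ruling v3.8-D (2)) -/

/-- `WlowM p` ⇒ the complement-of-(F1) row `Wlow3TwoM p` (restrict the origin, shrink the grade). [folklore] -/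
theorem wlow3TwoM_of_wlowM {p : ℕ} (h : WlowM p) : Wlow3TwoM.{0} p :=
  fun e he => (MaxOriginNoMovingNearChainAt.toQ h _).mono fun s hs => by
    show s.geomDirDim ≤ 2
    omega

/-- `WlowM p` ⇒ the (F1)-regime row `Wlow3CharM p`. [folklore] -/
theorem wlow3CharM_of_wlowM {p : ℕ} (h : WlowM p) : Wlow3CharM.{0} p :=
  fun e he => (MaxOriginNoMovingNearChainAt.toQ h _).mono fun s hs => by
    show s.geomDirDim ≤ 2
    omega

/-- **THE ROW `stub_Wlow3M_two` CLOSED MODULO ITS FOUR INPUTS AT THE PRIME 2 (PROVED assembly).** Inputs, all at `p = 2`: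
the char-free typed F-key `KeyTheorem640_isolated` (= print + 2.14♯ + memo at `e = ē = 2`), the restricted third door
(Cor. 6.37-type termination at isolated W-low stages with `e ≤ 1`; from `Corollary637_geomDir` + 2.14♯ via a point-sequence
bridge — NOT proved here), the characteristic-free extraction `UnitTowerExtractionFreeM 2` (bridge B1′, finite segments — NOT
proved here), and the strata-half `WlowStrataM 2` (G1′ — NOT proved here). Every other prime is vacuous
(`stub_Wlow3M_two_of_two`). [folklore] -/
theorem stub_Wlow3M_two_of_free (hK : KeyTheorem640_isolated.{0})
    (hlow : ∀ (R : ∀ S : Scheme.{0}, CentreSeq S → Prop), OracleFunctional R → OracleAdmissible R →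
      ∀ (ν : ℕ → ℕ) (s : MarkedStage.{0}), InScopeM 2 R 3 ν s → Iso 3 s → dirDim s ≤ 1 → s.geomDirDim ≤ 2 →
        NoMovingNearChainFrom R 3 ν s fun _ => True)
    (hext : UnitTowerExtractionFreeM 2) (hS : WlowStrataM 2) : ∀ p : ℕ, p.Prime → Wlow3TwoM.{0} p :=
  stub_Wlow3M_two_of_two (wlow3TwoM_of_wlowM (wlowM_assembled_free hK hlow hext hS))

/-- **BOTH registered W-low rows from the SAME characteristic-free inputs, prime by prime (PROVED)** — the (F1) / ¬(F1)
regime cut inside the skeleton is bookkeeping once Thm. 6.40 is consumed in its char-free form (ruling v3.8-D (2)). [folklore] -/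
theorem wlow_rows_of_free (hK : KeyTheorem640_isolated.{0})
    (hlow : ∀ p : ℕ, p.Prime → ∀ (R : ∀ S : Scheme.{0}, CentreSeq S → Prop), OracleFunctional R → OracleAdmissible R →
      ∀ (ν : ℕ → ℕ) (s : MarkedStage.{0}), InScopeM p R 3 ν s → Iso 3 s → dirDim s ≤ 1 → s.geomDirDim ≤ 2 →
        NoMovingNearChainFrom R 3 ν s fun _ => True)
    (hext : ∀ p : ℕ, p.Prime → UnitTowerExtractionFreeM p) (hS : ∀ p : ℕ, p.Prime → WlowStrataM p) :
    (∀ p : ℕ, p.Prime → Wlow3CharM.{0} p) ∧ (∀ p : ℕ, p.Prime → Wlow3TwoM.{0} p) :=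
  ⟨fun p hp => wlow3CharM_of_wlowM (wlowM_assembled_free hK (hlow p hp) (hext p hp) (hS p hp)),
   fun p hp => wlow3TwoM_of_wlowM (wlowM_assembled_free hK (hlow p hp) (hext p hp) (hS p hp))⟩

end Two

end Summit.ResolutionOfSingularities.ResolutionOfSingularities.Theorems.SigmaMaxModificationsCorridor3.Moving

end
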